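import Literature.MathematicalPhysics.QuantumManyBody.StateRelaxationKKT
import Literature.MathematicalPhysics.QuantumLattice.PairFieldMomentum
import Literature.MathematicalPhysics.QuantumLattice.HubbardModelGrandCanonicalProofs
import HarnessLib

/-!
# Charge-graded ("number-changing") KKT blocks under a grand-canonical ground state, and the
# chemical-potential envelope from convexity chords

Topic `Literature/MathematicalPhysics/QuantumManyBody`; namespace
`Literature.MathematicalPhysics.QuantumManyBody.StateRelaxation` (continuation of
`StateRelaxationKKT`). Everything here is PROVED; no definition and no named fact is introduced.

`StateRelaxationKKT` proves the state-optimality ("KKT", ground-state) block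
`[ω(B_a⋆ (h B_b − B_b h))]_{ab} ⪰ 0` in the PSD-multiplier form `0 ≤ Re ω(kktForm h G B)` for every
state `ω` obeying the ground-state inequality `Re ω(C⋆ (h C − C h)) ≥ 0` on the span of the
generators (`re_map_kktForm_nonneg`), and instantiates it for SECTOR ground states with
sector-PRESERVING generators (`re_vectorState_kktForm_nonneg_of_sectorGS`): charge-changing
generators are not covered there, because for them the inequality involves the neighbouring
sector's energy, i.e. a chemical potential.

This file adds the charge-graded case (Bratteli–Robinson II, Def. 5.3.18 / Prop. 5.3.19 for the
gauge-modified dynamics generated by `h − μ ν`, `ν` the particle number):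

* **Graded identity** (`kktForm_sub_smul_of_commutator`). If every generator carries the same
  `ν`-charge, `ν B_b − B_b ν = c • B_b`, then
  `kktForm (h − μ•ν) G B = kktForm h G B − (μ c) • gramForm G B`.
* **Exact-`μ` block** (`mul_re_map_gramForm_le_re_map_kktForm`). If `ω` obeys the ground-state
  inequality for `h − μ•ν` on the span of such a family and `G ⪰ 0`, then
  `μ c · Re ω(gramForm G B) ≤ Re ω(kktForm h G B)` — the block `[ω(B_a⋆ [h, B_b])] − μ c [ω(B_a⋆ B_b)] ⪰ 0`
  in multiplier form.
* **One-sided envelope** (`re_map_kktForm_add_mul_nonneg_of_chargeLowering`,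
  `re_map_kktForm_sub_mul_nonneg_of_chargeRaising`). Since `Re ω(gramForm G B) ≥ 0` for `G ⪰ 0`
  and positive `ω` (`map_gramForm_nonneg`), the unknown `μ` may be replaced by any UPPER bound
  `μ ≤ μ̄` on a charge-LOWERING family (`c = −q`, `q ≥ 0`): `0 ≤ Re ω(kktForm h G B) + q μ̄ Re ω(gramForm G B)`,
  and by any LOWER bound `μ_ ≤ μ` on a charge-RAISING family (`c = q`):
  `0 ≤ Re ω(kktForm h G B) − q μ_ Re ω(gramForm G B)`. These are the rows a rounded dual certificate
  consumes; the hypothesis on `ω` (ground-state inequality for `h − μ•ν` on number-changing local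
  generators) is the user's LICENCE and is NOT discharged here for thermodynamic-limit states.
* **Finite volume, fully proved** (`mul_re_expect_gramForm_le_re_expect_kktForm_of_gcGroundState`,
  `re_expect_kktForm_pairAnnihilation_nonneg_of_gcGroundState`): for a ground state `ψ` of the
  Hermitian matrix `A − μ•N` on the WHOLE space the licence holds for every generator
  (`re_expect_conjTranspose_mul_commutator_nonneg_of_sectorGS` with `K = ⊤`), whence the charged
  block for `A`; on the grand-canonical Hubbard torus `hubbardTorusWith d L t U μ = H − μ N`
  (`hubbardTorusWith_eq`) the on-site pair annihilators `c_{x↓} c_{x↑}` have charge `−2`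
  (`totalNumber_commutator_annihilation_mul_annihilation`), giving the "η-channel" block
  `0 ≤ Re⟨ψ, kktForm H G B ψ⟩ + 2 μ̄ Re⟨ψ, gramForm G B ψ⟩` for every `μ̄ ≥ μ` and `G ⪰ 0`.
* **Chemical-potential envelope** (`div_le_and_le_div_of_isMinOn_sub_mul`, `…_of_le_of_le`,
  `chemicalPotential_envelope_seven_eighths`): if `n₀ ∈ (0,1)` minimises the specific grand
  potential `n ↦ e n − μ n` on a set containing `0` and `1` and `e 0 = 0`, then
  `e n₀ / n₀ ≤ μ ≤ (e 1 − e n₀)/(1 − n₀)`; with certified `e_ ≤ e n₀` and `e 1 ≤ ē` this is the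
  computable envelope `e_/n₀ ≤ μ ≤ (ē − e_)/(1 − n₀)` (at `n₀ = 7/8`: `(8/7) e_ ≤ μ ≤ 8 (ē − e_)`).
  Elementary (two instances of the minimising inequality); for a convex `e` — e.g. the Hubbard
  energy density, `convexOn_energyDensity2D` (Ruelle 1969 §3.3) — every `n₀` is such a minimiser for
  the `μ` in its subdifferential.

Deliberately NOT here: infinite-volume (torus-limit) states and the existence of a translation-
invariant minimiser of the specific `(H − μN)`-energy at prescribed density (the thermodynamic-limit
licence); `InfVolFermionStateTorusLimitKKT` proves the gauge-INVARIANT case only.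

## References
* O. Bratteli, D. W. Robinson, *Operator Algebras and Quantum Statistical Mechanics 2*, 2nd ed.
  (1997), Def. 5.3.18, Prop. 5.3.19 (ground states: `−i ω(A⋆ δ(A)) ≥ 0` for all local `A`).
  [cite: BratteliRobinsonII1997, Prop. 5.3.19]
* M. Araújo, I. Klep, A. J. P. Garner, T. Vértesi, M. Navascués, *First-order optimality conditions
  for non-commutative optimization problems*, arXiv:2311.18707, §3.2 Prop. 11.
  [cite: AraujoEtAl2023, §3.2 Prop. 11]
* F. H. L. Essler et al., *The One-Dimensional Hubbard Model* (2005), §2.2.5 eq. (2.87)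
  (`[N, η] = −2η`). [cite: EsslerEtAl2005, §2.2.5 eq. (2.87)]
* D. Ruelle, *Statistical Mechanics: Rigorous Results* (1969), §3.3–3.4 (convexity of the
  thermodynamic functions; tangents and chords). [cite: Ruelle1969, §3.4]
-/

noncomputable section

open Matrix Finset
open scoped ComplexOrder MatrixOrder BigOperators

namespace Literature.MathematicalPhysics.QuantumManyBody.StateRelaxation

/-! ### Abstract `⋆`-algebra: the graded identity and the charged block -/

section Abstract

variable {𝓐 : Type*} [Ring 𝓐] [StarRing 𝓐] [Algebra ℂ 𝓐] [StarModule ℂ 𝓐]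
variable {m : Type*} [Fintype m]

/-- Envelope arithmetic, lowering side: `μ (−q) X ≤ K`, `0 ≤ X`, `0 ≤ q`, `μ ≤ μ̄` give
`0 ≤ K + q μ̄ X`. [folklore] -/
private theorem kktEnvelope_arith_lowering {K X μ μup q : ℝ} (hK : μ * (-q) * X ≤ K) (hX : 0 ≤ X)
    (hq : 0 ≤ q) (hμ : μ ≤ μup) : 0 ≤ K + q * μup * X := by
  have hmono : q * X * μ ≤ q * X * μup := mul_le_mul_of_nonneg_left hμ (mul_nonneg hq hX)
  nlinarith

/-- Envelope arithmetic, raising side: `μ q X ≤ K`, `0 ≤ X`, `0 ≤ q`, `μ_ ≤ μ` give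
`0 ≤ K − q μ_ X`. [folklore] -/
private theorem kktEnvelope_arith_raising {K X μ μlow q : ℝ} (hK : μ * q * X ≤ K) (hX : 0 ≤ X)
    (hq : 0 ≤ q) (hμ : μlow ≤ μ) : 0 ≤ K - q * μlow * X := by
  have hmono : q * X * μlow ≤ q * X * μ := mul_le_mul_of_nonneg_left hμ (mul_nonneg hq hX)
  nlinarith

omit [StarRing 𝓐] [StarModule ℂ 𝓐] in
/-- The commutator with the gauge-modified generator: if `ν B − B ν = c • B` (the generator `B`
carries `ν`-charge `c`) then `(h − μ•ν) B − B (h − μ•ν) = (h B − B h) − (μ c) • B`.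
[cite: BratteliRobinsonII1997, Prop. 5.3.19] -/
theorem sub_smul_mul_sub_mul_sub_smul_of_commutator (h ν B : 𝓐) (μ : ℂ) {c : ℂ}
    (hc : ν * B - B * ν = c • B) :
    (h - μ • ν) * B - B * (h - μ • ν) = (h * B - B * h) - (μ * c) • B := by
  have hc' : (μ * c) • B = μ • (ν * B) - μ • (B * ν) := by rw [mul_smul, ← hc, smul_sub]
  rw [hc', sub_mul, mul_sub, smul_mul_assoc, mul_smul_comm]
  abel

omit [StarModule ℂ 𝓐] in
/-- **Graded KKT identity.** For a generator family of common `ν`-charge `c`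
(`ν B_b − B_b ν = c • B_b` for all `b`), the KKT element of the gauge-modified generator `h − μ•ν`
is the KKT element of `h` shifted by the Gram element:
`kktForm (h − μ•ν) G B = kktForm h G B − (μ c) • gramForm G B`.
[cite: AraujoEtAl2023, §3.2 Prop. 11] -/
theorem kktForm_sub_smul_of_commutator (h ν : 𝓐) (μ : ℂ) (G : Matrix m m ℂ) (B : m → 𝓐) {c : ℂ}
    (hc : ∀ j, ν * B j - B j * ν = c • B j) :
    kktForm (h - μ • ν) G B = kktForm h G B - (μ * c) • gramForm G B := by
  unfold kktForm gramForm
  rw [Finset.smul_sum, ← Finset.sum_sub_distrib]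
  refine Finset.sum_congr rfl fun i _ => ?_
  rw [Finset.smul_sum, ← Finset.sum_sub_distrib]
  refine Finset.sum_congr rfl fun j _ => ?_
  rw [sub_smul_mul_sub_mul_sub_smul_of_commutator h ν (B j) μ (hc j), mul_sub, mul_smul_comm,
    smul_sub, smul_comm (G i j) (μ * c)]

/-- **The charged KKT block with the exact chemical potential.** If `ω` obeys the ground-state
inequality for the gauge-modified generator `h − μ•ν` on the span of a generator family of common
`ν`-charge `c`, and `G ⪰ 0`, then `μ c · Re ω(gramForm G B) ≤ Re ω(kktForm h G B)`, i.e. the block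
`[ω(B_a⋆ (h B_b − B_b h))] − μ c [ω(B_a⋆ B_b)] ⪰ 0` paired with `G` (Bratteli–Robinson II Prop. 5.3.19
for the dynamics of `h − μ ν`, in the PSD-weighted form of Araújo et al. Prop. 11).
[cite: BratteliRobinsonII1997, Prop. 5.3.19] -/
theorem mul_re_map_gramForm_le_re_map_kktForm [DecidableEq m] (ω : 𝓐 →ₗ[ℂ] ℂ) (h ν : 𝓐)
    (μ c : ℝ) {G : Matrix m m ℂ} (hG : G.PosSemidef) (B : m → 𝓐)
    (hc : ∀ j, ν * B j - B j * ν = (c : ℂ) • B j)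
    (hstab : ∀ w : m → ℂ, 0 ≤ (ω (star (∑ j, w j • B j) *
      ((h - (μ : ℂ) • ν) * (∑ j, w j • B j) - (∑ j, w j • B j) * (h - (μ : ℂ) • ν)))).re) :
    μ * c * (ω (gramForm G B)).re ≤ (ω (kktForm h G B)).re := by
  have h0 := re_map_kktForm_nonneg ω (h - (μ : ℂ) • ν) hG B hstab
  rw [kktForm_sub_smul_of_commutator h ν (μ : ℂ) G B hc, map_sub, map_smul, Complex.sub_re,
    smul_eq_mul, ← Complex.ofReal_mul, Complex.re_ofReal_mul] at h0
  linarith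

/-- **One-sided envelope, charge-lowering family.** For generators LOWERING the `ν`-charge by
`q ≥ 0` (`ν B_b − B_b ν = −(q • B_b)`), a positive `ω` obeying the ground-state inequality for
`h − μ•ν` on their span, `G ⪰ 0`, and ANY upper bound `μ ≤ μ̄`:
`0 ≤ Re ω(kktForm h G B) + q μ̄ Re ω(gramForm G B)` — replacing the unknown `μ` by `μ̄` only weakens
the block because `Re ω(gramForm G B) ≥ 0` (`map_gramForm_nonneg`).
[cite: BratteliRobinsonII1997, Prop. 5.3.19] -/
theorem re_map_kktForm_add_mul_nonneg_of_chargeLowering [DecidableEq m] (ω : 𝓐 →ₗ[ℂ] ℂ)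
    (hpos : ∀ a, 0 ≤ ω (star a * a)) (h ν : 𝓐) {μ μup q : ℝ} (hμ : μ ≤ μup) (hq : 0 ≤ q)
    {G : Matrix m m ℂ} (hG : G.PosSemidef) (B : m → 𝓐)
    (hc : ∀ j, ν * B j - B j * ν = -((q : ℂ) • B j))
    (hstab : ∀ w : m → ℂ, 0 ≤ (ω (star (∑ j, w j • B j) *
      ((h - (μ : ℂ) • ν) * (∑ j, w j • B j) - (∑ j, w j • B j) * (h - (μ : ℂ) • ν)))).re) :
    0 ≤ (ω (kktForm h G B)).re + q * μup * (ω (gramForm G B)).re := by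
  have hc' : ∀ j, ν * B j - B j * ν = ((-q : ℝ) : ℂ) • B j := fun j => by
    rw [hc j, Complex.ofReal_neg, neg_smul]
  exact kktEnvelope_arith_lowering (mul_re_map_gramForm_le_re_map_kktForm ω h ν μ (-q) hG B hc' hstab)
    (Complex.nonneg_iff.1 (map_gramForm_nonneg ω hpos hG B)).1 hq hμ

/-- **One-sided envelope, charge-raising family.** For generators RAISING the `ν`-charge by
`q ≥ 0` (`ν B_b − B_b ν = q • B_b`), a positive `ω` obeying the ground-state inequality for
`h − μ•ν` on their span, `G ⪰ 0`, and ANY lower bound `μ_ ≤ μ`: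
`0 ≤ Re ω(kktForm h G B) − q μ_ Re ω(gramForm G B)`.
[cite: BratteliRobinsonII1997, Prop. 5.3.19] -/
theorem re_map_kktForm_sub_mul_nonneg_of_chargeRaising [DecidableEq m] (ω : 𝓐 →ₗ[ℂ] ℂ)
    (hpos : ∀ a, 0 ≤ ω (star a * a)) (h ν : 𝓐) {μ μlow q : ℝ} (hμ : μlow ≤ μ) (hq : 0 ≤ q)
    {G : Matrix m m ℂ} (hG : G.PosSemidef) (B : m → 𝓐)
    (hc : ∀ j, ν * B j - B j * ν = (q : ℂ) • B j)
    (hstab : ∀ w : m → ℂ, 0 ≤ (ω (star (∑ j, w j • B j) *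
      ((h - (μ : ℂ) • ν) * (∑ j, w j • B j) - (∑ j, w j • B j) * (h - (μ : ℂ) • ν)))).re) :
    0 ≤ (ω (kktForm h G B)).re - q * μlow * (ω (gramForm G B)).re := by
  exact kktEnvelope_arith_raising (mul_re_map_gramForm_le_re_map_kktForm ω h ν μ q hG B hc hstab)
    (Complex.nonneg_iff.1 (map_gramForm_nonneg ω hpos hG B)).1 hq hμ

end Abstract

/-! ### Matrix instances: ground states of `A − μ N` on the whole space -/

section MatrixInstances

open Literature.MathematicalPhysics.QuantumLattice

variable {n : Type*} [Fintype n] [DecidableEq n]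
variable {m : Type*} [Fintype m] [DecidableEq m]

/-- **Finite volume, grand-canonical ground state, exact `μ`.** Let `A`, `N` be Hermitian matrices,
`μ : ℝ`, `ψ` a ground state of `A − μ•N` on the WHOLE space
(`(A − μ N) ψ = E ψ`, `E = minEnergyOn (A − μ N) ⊤`), `B_b` a generator family of common `N`-charge
`c` (`N B_b − B_b N = c • B_b`) and `G ⪰ 0`. Then
`μ c · Re⟨ψ, gramForm G B ψ⟩ ≤ Re⟨ψ, kktForm A G B ψ⟩`: the ground-state inequality holds for EVERY
generator (no sector restriction: `K = ⊤` in `re_expect_conjTranspose_mul_commutator_nonneg_of_sectorGS`),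
and the graded identity moves the `μ N` term into the Gram block.
[cite: BratteliRobinsonII1997, Prop. 5.3.19] -/
theorem mul_re_expect_gramForm_le_re_expect_kktForm_of_gcGroundState {A N : Matrix n n ℂ}
    (hA : A.IsHermitian) (hN : N.IsHermitian) (μ c : ℝ) {G : Matrix m m ℂ} (hG : G.PosSemidef)
    (B : m → Matrix n n ℂ) (hc : ∀ j, N * B j - B j * N = (c : ℂ) • B j) {ψ : n → ℂ}
    (hψ : (A - (μ : ℂ) • N) *ᵥ ψ = (((A - (μ : ℂ) • N).minEnergyOn ⊤ : ℝ) : ℂ) • ψ) :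
    μ * c * (star ψ ⬝ᵥ gramForm G B *ᵥ ψ).re ≤ (star ψ ⬝ᵥ kktForm A G B *ᵥ ψ).re := by
  have hA' : (A - (μ : ℂ) • N).IsHermitian := by
    rw [Matrix.IsHermitian, conjTranspose_sub, conjTranspose_smul, hA.eq, hN.eq, Complex.star_def,
      Complex.conj_ofReal]
  have h := mul_re_map_gramForm_le_re_map_kktForm (vectorState ψ) A N μ c hG B hc fun w => by
    rw [vectorState_apply, Matrix.star_eq_conjTranspose]
    exact re_expect_conjTranspose_mul_commutator_nonneg_of_sectorGS hA' ⊤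
      (fun v _ => Submodule.mem_top) Submodule.mem_top hψ
  rwa [vectorState_apply, vectorState_apply] at h

/-- **Hubbard torus, grand-canonical ground state, η-channel block with an envelope `μ̄ ≥ μ`.**
For a ground state `ψ` of `hubbardTorusWith d L t U μ = H − μ N` (`hubbardTorusWith_eq`) on the
whole Fock space of the torus `(ℤ/Lℤ)^d`, on-site
pair annihilators `B_b = c_{x_b ↓} c_{x_b ↑}` (charge `−2`:
`totalNumber_commutator_annihilation_mul_annihilation`), `G ⪰ 0` and any `μ̄ ≥ μ`:
`0 ≤ Re⟨ψ, kktForm H G B ψ⟩ + 2 μ̄ Re⟨ψ, gramForm G B ψ⟩`, `H = hubbardTorus d L t U`.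
[cite: EsslerEtAl2005, §2.2.5 eq. (2.87)] -/
theorem re_expect_kktForm_pairAnnihilation_nonneg_of_gcGroundState {d L : ℕ} (t U : ℝ)
    {μ μup : ℝ} (hμ : μ ≤ μup) {G : Matrix m m ℂ} (hG : G.PosSemidef) (x : m → FermionTorus d L)
    {ψ : Fock (Orb (FermionTorus d L))}
    (hψ : hubbardTorusWith d L t U μ *ᵥ ψ =
      (((hubbardTorusWith d L t U μ).minEnergyOn ⊤ : ℝ) : ℂ) • ψ) :
    0 ≤ (star ψ ⬝ᵥ kktForm (hubbardTorus d L t U) G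
          (fun j => annihilation (orb (x j) 1) * annihilation (orb (x j) 0)) *ᵥ ψ).re +
      2 * μup * (star ψ ⬝ᵥ gramForm G
          (fun j => annihilation (orb (x j) 1) * annihilation (orb (x j) 0)) *ᵥ ψ).re := by
  rw [hubbardTorusWith_eq] at hψ
  have hc : ∀ j, totalNumber * (annihilation (orb (x j) 1) * annihilation (orb (x j) 0)) -
      annihilation (orb (x j) 1) * annihilation (orb (x j) 0) * totalNumber =
        ((-2 : ℝ) : ℂ) • (annihilation (orb (x j) 1) * annihilation (orb (x j) 0)) := fun j => by
    rw [totalNumber_commutator_annihilation_mul_annihilation, Complex.ofReal_neg, Complex.ofReal_ofNat]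
  have hX := (Complex.nonneg_iff.1 (map_gramForm_nonneg (vectorState ψ) (vectorState_nonneg ψ) hG
    (fun j => annihilation (orb (x j) 1) * annihilation (orb (x j) 0)))).1
  rw [vectorState_apply] at hX
  exact kktEnvelope_arith_lowering (mul_re_expect_gramForm_le_re_expect_kktForm_of_gcGroundState
    (hubbardTorus_isHermitian (hamiltonian_isHermitian_and_commute_holds _) t U)
    totalNumber_isHermitian μ (-2) hG _ hc hψ) hX (by norm_num) hμ

end MatrixInstances

/-! ### The chemical-potential envelope from convexity chords -/

section ChemicalPotentialEnvelope

/-- **Chord bounds on the chemical potential.** If `n₀ ∈ (0, 1)` minimises the specific grand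
potential `n ↦ e n − μ n` on a set `S ∋ 0, 1` and `e 0 = 0`, then
`e n₀ / n₀ ≤ μ ≤ (e 1 − e n₀) / (1 − n₀)`: the multiplier lies between the slopes of the chords of
`e` from `(0, 0)` to `(n₀, e n₀)` and from `(n₀, e n₀)` to `(1, e 1)`. (For convex `e` every `μ` in the
subdifferential at `n₀` makes `n₀` such a minimiser; Ruelle 1969 §3.4.) [cite: Ruelle1969, §3.4] -/
theorem div_le_and_le_div_of_isMinOn_sub_mul {e : ℝ → ℝ} {S : Set ℝ} {n₀ μ : ℝ} (hn₀ : 0 < n₀)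
    (hn₁ : n₀ < 1) (he₀ : e 0 = 0) (h0 : (0 : ℝ) ∈ S) (h1 : (1 : ℝ) ∈ S)
    (hmin : IsMinOn (fun n => e n - μ * n) S n₀) :
    e n₀ / n₀ ≤ μ ∧ μ ≤ (e 1 - e n₀) / (1 - n₀) := by
  have hm0 : e n₀ - μ * n₀ ≤ e 0 - μ * 0 := hmin h0
  have hm1 : e n₀ - μ * n₀ ≤ e 1 - μ * 1 := hmin h1
  rw [he₀] at hm0
  constructor
  · rw [div_le_iff₀ hn₀]; linarith
  · rw [le_div_iff₀ (by linarith)]; linarith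

/-- **The certified envelope.** Under the hypotheses of `div_le_and_le_div_of_isMinOn_sub_mul`,
any certified LOWER bound `e_ ≤ e n₀` at the density and certified UPPER bound `e 1 ≤ ē` at `n = 1`
give the computable envelope `e_ / n₀ ≤ μ ≤ (ē − e_) / (1 − n₀)`. [cite: Ruelle1969, §3.4] -/
theorem div_le_and_le_div_of_isMinOn_sub_mul_of_le_of_le {e : ℝ → ℝ} {S : Set ℝ}
    {n₀ μ elow eup : ℝ} (hn₀ : 0 < n₀) (hn₁ : n₀ < 1) (he₀ : e 0 = 0) (h0 : (0 : ℝ) ∈ S)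
    (h1 : (1 : ℝ) ∈ S) (hmin : IsMinOn (fun n => e n - μ * n) S n₀) (hlow : elow ≤ e n₀)
    (hup : e 1 ≤ eup) :
    elow / n₀ ≤ μ ∧ μ ≤ (eup - elow) / (1 - n₀) := by
  obtain ⟨hl, hu⟩ := div_le_and_le_div_of_isMinOn_sub_mul hn₀ hn₁ he₀ h0 h1 hmin
  constructor
  · exact (div_le_div_of_nonneg_right hlow hn₀.le).trans hl
  · refine hu.trans (div_le_div_of_nonneg_right ?_ (by linarith))
    linarith

/-- **The envelope at density `7/8`.** With `n₀ = 7/8`: `(8/7) e_ ≤ μ ≤ 8 (ē − e_)`; e.g. at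
`(U, t′) = (8, 0)` with the certified `e_ = e_low(8, 7/8, 0)` and `ē = e_up(8, 1, 0)` of record
(any such pair may be substituted; nothing numerical is fixed here). [cite: Ruelle1969, §3.4] -/
theorem chemicalPotential_envelope_seven_eighths {e : ℝ → ℝ} {S : Set ℝ} {μ elow eup : ℝ}
    (he₀ : e 0 = 0) (h0 : (0 : ℝ) ∈ S) (h1 : (1 : ℝ) ∈ S)
    (hmin : IsMinOn (fun n => e n - μ * n) S (7 / 8)) (hlow : elow ≤ e (7 / 8))
    (hup : e 1 ≤ eup) :
    8 / 7 * elow ≤ μ ∧ μ ≤ 8 * (eup - elow) := by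
  obtain ⟨hl, hu⟩ := div_le_and_le_div_of_isMinOn_sub_mul_of_le_of_le (by norm_num) (by norm_num)
    he₀ h0 h1 hmin hlow hup
  constructor
  · rw [div_eq_inv_mul] at hl; norm_num at hl; linarith
  · norm_num at hu; linarith

end ChemicalPotentialEnvelope

end Literature.MathematicalPhysics.QuantumManyBody.StateRelaxation
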